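import Literature.Topology.FourManifolds.SurfaceTimesTorusTube
import HarnessLib

/-!
# The quarter-circle parametrisation `t ↦ exp(i arctan(t)/2)` and its rational left inverse

Topic `Literature/Topology/FourManifolds` (fact seat of the Seiberg–Witten leaf
`Literature.Barriers.SmoothPoincare4.akhmedovPark2010_lemma8_invariants`; block 1 of
Akhmedov–Park's `X₁(m)`, A. Akhmedov, B. D. Park, Invent. Math. 181 (2010), §9 eq. (9.1): the four
Luttinger surgery tori `a₁′ × c′`, `b₁′ × c″`, `a₂′ × c′`, `a₂″ × d′` of `Σ₂ × T²` use PARALLEL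
copies `c′`, `c″` of the circle `c` of `T²`, disjoint from each other and from the disc
`(½, ½)` over which the fibre `Σ₂ × {pt}` is summed).  In the tube coordinates of
`SurfaceTimesTorusTube.lean` the fibre tube occupies the open half circle `Re z > 0` of each
circle factor (`t ↦ exp(i arctan t)`, §Arc there); the tubes of the parallel circles `c′`, `c″`
must then be placed in disjoint sub-arcs of the complementary half circle, which requires arcs of
angular half-width `π/4`.  This file supplies the **quarter-circle parametrisation**
`t ↦ exp(i arctan(t)/2)` of the open arc `{|arg z| < π/4} = {Re z > 0, Re z² > 0}` together with
its RATIONAL left inverse `z ↦ Im(z²)/Re(z²) = tan(2 arg z)` (no branch of `arg` is needed: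
squaring reduces everything to the half-circle lemmas of `SurfaceTimesTorusTube.lean`), in the
shape used there for tubes (`isSmoothEmbedding_of_leftInverse_of_isOpenMap`): injective, smooth,
open, with the range described by two strict inequalities.  Everything is proved; no definitions.

* `circleExp_half_mul_self` — `exp(ia/2) · exp(ia/2) = exp(ia)`;
* `re_circleExp_arctan_half_pos`, `re_sq_circleExp_arctan_half_pos` — the point
  `w = exp(i arctan(t)/2)` has `Re w > 0` and `Re w² > 0`;
* `im_sq_div_re_sq_circleExp_arctan_half` — `Im(w²)/Re(w²) = t` (left inverse);
* `circleExp_arctan_half_eq` — conversely `exp(i arctan(Im z²/Re z²)/2) = z` when `Re z > 0`,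
  `Re z² > 0` (the two square roots of `z²` are `±z`, and `-z` has negative real part);
* `injective_/contMDiff_/isOpenMap_circleExp_arctan_half`, `range_circleExp_arctan_half`.

## References

* A. Akhmedov, B. D. Park, Invent. Math. 181 (2010), §9, eq. (9.1) and Fig./text "parallel
  copies `c′`, `c″`". [AkhmedovPark2010]
* J. M. Lee, *Introduction to Smooth Manifolds* (2013), Prop. 5.2 (images of embeddings).
  [LeeSmoothManifolds2013]
-/

noncomputable section

open scoped Manifold ContDiff Topology Real
open Set Function

namespace Literature.Topology.FourManifolds

/-- `exp(ia/2) · exp(ia/2) = exp(ia)` in the circle group. [folklore] -/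
theorem circleExp_half_mul_self (a : ℝ) : Circle.exp (a / 2) * Circle.exp (a / 2) = Circle.exp a := by
  rw [← Circle.exp_add, add_halves]

/-- The square of `exp(i arctan(t)/2)`, as a complex number, is `exp(i arctan t)`. [folklore] -/
theorem coe_circleExp_arctan_half_sq (t : ℝ) :
    ((Circle.exp (Real.arctan t / 2) : Circle) : ℂ) ^ 2 =
      ((Circle.exp (Real.arctan t) : Circle) : ℂ) := by
  rw [sq, ← Circle.coe_mul, circleExp_half_mul_self]

/-- `exp(i arctan(t)/2)` has positive real part (`|arctan(t)/2| < π/4`). [folklore] -/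
theorem re_circleExp_arctan_half_pos (t : ℝ) :
    0 < ((Circle.exp (Real.arctan t / 2) : Circle) : ℂ).re := by
  rw [Circle.coe_exp, Complex.exp_ofReal_mul_I_re]
  refine Real.cos_pos_of_mem_Ioo ⟨?_, ?_⟩
  · have := Real.neg_pi_div_two_lt_arctan t
    linarith [Real.pi_pos]
  · have := Real.arctan_lt_pi_div_two t
    linarith [Real.pi_pos]

/-- `exp(i arctan(t)/2)` has square with positive real part. [folklore] -/
theorem re_sq_circleExp_arctan_half_pos (t : ℝ) :
    0 < (((Circle.exp (Real.arctan t / 2) : Circle) : ℂ) ^ 2).re := by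
  rw [coe_circleExp_arctan_half_sq]
  exact re_circleExp_arctan_pos t

/-- **The rational left inverse**: `Im(w²)/Re(w²) = t` for `w = exp(i arctan(t)/2)`
(`= tan (2 · arctan(t)/2)`). [folklore] -/
theorem im_sq_div_re_sq_circleExp_arctan_half (t : ℝ) :
    (((Circle.exp (Real.arctan t / 2) : Circle) : ℂ) ^ 2).im /
        (((Circle.exp (Real.arctan t / 2) : Circle) : ℂ) ^ 2).re = t := by
  rw [coe_circleExp_arctan_half_sq]
  exact im_div_re_circleExp_arctan t

/-- `t ↦ exp(i arctan(t)/2)` is injective. [folklore] -/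
theorem injective_circleExp_arctan_half :
    Injective fun t : ℝ => Circle.exp (Real.arctan t / 2) := by
  intro s t h
  have := congrArg (fun z : Circle => ((z : ℂ) ^ 2).im / ((z : ℂ) ^ 2).re) h
  simpa only [im_sq_div_re_sq_circleExp_arctan_half] using this

/-- `t ↦ exp(i arctan(t)/2)` is smooth. [folklore] -/
theorem contMDiff_circleExp_arctan_half :
    ContMDiff 𝓘(ℝ, ℝ) (𝓡 1) ∞ fun t : ℝ => Circle.exp (Real.arctan t / 2) :=
  contMDiff_circleExp.comp (Real.contDiff_arctan.div_const 2).contMDiff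

/-- `t ↦ exp(i arctan(t)/2)` is an open map. [folklore] -/
theorem isOpenMap_circleExp_arctan_half :
    IsOpenMap fun t : ℝ => Circle.exp (Real.arctan t / 2) := by
  have h1 : IsOpenMap Real.arctan := by
    have : Real.arctan = (Subtype.val : Ioo (-(π / 2)) (π / 2) → ℝ) ∘ Real.tanOrderIso.symm := by
      funext t; rfl
    rw [this]
    exact isOpen_Ioo.isOpenMap_subtype_val.comp Real.tanOrderIso.symm.toHomeomorph.isOpenMap
  have h2 : IsOpenMap fun a : ℝ => a / 2 := by
    have hfun : (⇑(Homeomorph.mulRight₀ (2⁻¹ : ℝ) (by norm_num)) : ℝ → ℝ) = fun a => a / 2 :=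
      funext fun a => by rw [div_eq_mul_inv]; rfl
    rw [← hfun]
    exact (Homeomorph.mulRight₀ (2⁻¹ : ℝ) (by norm_num)).isOpenMap
  exact isLocalHomeomorph_circleExp.isOpenMap.comp (h2.comp h1)

/-- **A point of the circle with `Re z > 0` and `Re z² > 0` (i.e. `|arg z| < π/4`) is
`exp(i arctan(s)/2)` for `s = Im z² / Re z²`**: both sides square to `z²`
(`circleExp_arctan_im_div_re` for `z²`), and of the two square roots `±z` only `z` has positive
real part. [folklore] -/
theorem circleExp_arctan_half_eq {z : Circle} (hz : 0 < (z : ℂ).re)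
    (hz2 : 0 < ((z : ℂ) ^ 2).re) :
    Circle.exp (Real.arctan (((z : ℂ) ^ 2).im / ((z : ℂ) ^ 2).re) / 2) = z := by
  have hsq : ((z ^ 2 : Circle) : ℂ) = (z : ℂ) ^ 2 := by rw [sq, sq, Circle.coe_mul]
  have hz2' : 0 < ((z ^ 2 : Circle) : ℂ).re := by rw [hsq]; exact hz2
  have h2 : Circle.exp (Real.arctan (((z : ℂ) ^ 2).im / ((z : ℂ) ^ 2).re)) = z ^ 2 := by
    have := circleExp_arctan_im_div_re hz2'
    rwa [hsq] at this
  set w := Circle.exp (Real.arctan (((z : ℂ) ^ 2).im / ((z : ℂ) ^ 2).re) / 2) with hw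
  have hw2 : (w : ℂ) ^ 2 = (z : ℂ) ^ 2 := by
    rw [hw, coe_circleExp_arctan_half_sq, h2, hsq]
  have hwre : 0 < (w : ℂ).re := re_circleExp_arctan_half_pos _
  rcases sq_eq_sq_iff_eq_or_eq_neg.1 hw2 with h | h
  · exact Circle.ext h
  · exfalso
    have : (w : ℂ).re = -(z : ℂ).re := by rw [h, Complex.neg_re]
    linarith

/-- **The range of the quarter-circle parametrisation** is the open arc
`{Re z > 0, Re z² > 0} = {|arg z| < π/4}`. [folklore] -/
theorem range_circleExp_arctan_half :
    range (fun t : ℝ => Circle.exp (Real.arctan t / 2)) =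
      {z : Circle | 0 < (z : ℂ).re ∧ 0 < ((z : ℂ) ^ 2).re} := by
  ext z
  constructor
  · rintro ⟨t, rfl⟩
    exact ⟨re_circleExp_arctan_half_pos t, re_sq_circleExp_arctan_half_pos t⟩
  · rintro ⟨hz, hz2⟩
    exact ⟨_, circleExp_arctan_half_eq hz hz2⟩

/-- The open arc `{Re z > 0, Re z² > 0}` is open in the circle. [folklore] -/
theorem isOpen_setOf_re_pos_re_sq_pos :
    IsOpen {z : Circle | 0 < (z : ℂ).re ∧ 0 < ((z : ℂ) ^ 2).re} := by
  have hc : Continuous fun z : Circle => (z : ℂ) := continuous_subtype_val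
  exact (isOpen_lt continuous_const (Complex.continuous_re.comp hc)).inter
    (isOpen_lt continuous_const (Complex.continuous_re.comp (hc.pow 2)))

/-- **Rotated arcs.**  For a centre `θ ∈ S¹` the arc `t ↦ θ · exp(i arctan(t)/2)` has range
`{z | Re (z θ⁻¹) > 0 ∧ Re ((z θ⁻¹)²) > 0}` — the open arc of angular half-width `π/4` about `θ`.
(For the circles `c′`, `c″` of Akhmedov–Park's eq. (9.1) one takes two centres in the half
circle `Re z < 0` at angular distance `π/2`, e.g. `θ = exp(3πi/4)`, `exp(5πi/4)`; the
corresponding arcs are disjoint from each other and from the half circle `Re z > 0` of the fibre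
tube — elementary consequences of this range formula, proved where they are used.) [folklore] -/
theorem range_mul_circleExp_arctan_half (θ : Circle) :
    range (fun t : ℝ => θ * Circle.exp (Real.arctan t / 2)) =
      {z : Circle | 0 < ((z * θ⁻¹ : Circle) : ℂ).re ∧ 0 < (((z * θ⁻¹ : Circle) : ℂ) ^ 2).re} := by
  ext z
  constructor
  · rintro ⟨t, rfl⟩
    simp only [mem_setOf_eq, mul_inv_cancel_comm]
    exact ⟨re_circleExp_arctan_half_pos t, re_sq_circleExp_arctan_half_pos t⟩
  · rintro ⟨hz, hz2⟩
    refine ⟨((((z * θ⁻¹ : Circle) : ℂ) ^ 2).im / (((z * θ⁻¹ : Circle) : ℂ) ^ 2).re), ?_⟩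
    show θ * Circle.exp _ = z
    rw [circleExp_arctan_half_eq hz hz2, mul_comm, inv_mul_cancel_right]

/-- `t ↦ θ · exp(i arctan(t)/2)` is injective, smooth and open (left multiplication by `θ` is a
diffeomorphism of the Lie group `S¹`). [folklore] -/
theorem injective_contMDiff_isOpenMap_mul_circleExp_arctan_half (θ : Circle) :
    Injective (fun t : ℝ => θ * Circle.exp (Real.arctan t / 2)) ∧
      ContMDiff 𝓘(ℝ, ℝ) (𝓡 1) ∞ (fun t : ℝ => θ * Circle.exp (Real.arctan t / 2)) ∧
      IsOpenMap (fun t : ℝ => θ * Circle.exp (Real.arctan t / 2)) := by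
  refine ⟨fun s t h => injective_circleExp_arctan_half (mul_left_cancel h), ?_, ?_⟩
  · exact contMDiff_mul_left.comp contMDiff_circleExp_arctan_half
  · exact (Homeomorph.mulLeft θ).isOpenMap.comp isOpenMap_circleExp_arctan_half

end Literature.Topology.FourManifolds
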